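import Literature.MathematicalPhysics.QuantumFieldTheory.Balaban1983to89.B11

/-!
# `Balaban1983to89.B11Thm1Exact` — [Balaban1985Variational] Theorem 1 with the printed cube-size ceiling
# `M(ε₁) = R₁M₁(a₁/ε₁)` encoded (the clause the tree's `B11.Thm1Printed` leaves as an arbitrary positive function)

statement-level skeleton of published theorems with citation tags; proofs where landed; nothing here is a claim about the Yang–Mills mass gap

CITATION HEADER (lean-in-tree rule 2026-08-18).  T. Bałaban, *The variational problem and background fields in
renormalization group method for lattice gauge theories*, Commun. Math. Phys. **102**, 277–309 (1985),
doi:10.1007/bf01229381 [Balaban1985Variational] (cell paper B11; held `paper:balaban1985-cmp102-variational-background`,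
journal page = PDF page + 276).  Renders READ AS IMAGES by this seat (lit-balaban reader/typer r08, 2026-08-20):
`run/shared/lean/pub/pub-balaban/b2b-balaban-ref1/pages/1985-cmp102-variational-background/…-p003-x2.png` (p. 279,
Theorem 1), `…-p028-x2.png` (p. 304, definition of a₁, «M′ = (R₁M₁)^{-1}M»); p. 277 (1) and p. 305 (169) from the
render-verified transcript `run/shared/lean/pub/pub-balaban/b2b-balaban-b11/transcript.md`.

WHY THIS FILE.  Theorem 1 (p. 279) ends: *«The constants a₀, a₁, B₃, depend on d and L only, the constants B₄(β₀), M(ε₁)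
depend on the indicated parameters also. More exactly M(ε₁) = R₁M₁(a₁/ε₁).»*  The tree's statement-level typing
`B11.Thm1Printed` (cell b2b-balaban, reader r2) quantifies `∃ Mfun : ℝ → ℝ` (any positive function), which the
lit-balaban referee recorded as *weaker-than-print* (HOME/lit-balaban-ref-1/REFEREE.md, ROW pre-03, NOTE F7).  Here the
last sentence is typed: `R₁M₁` is the FIXED number of the geometric setting (p. 277, (1): *«the numbers R₁, M₁ are fixed
in such a way that all the results of [3,5,6] hold for these numbers»*), a parameter chosen before everything else, and
the regularity clause (9)–(10) is asserted for cubes of size `2ML^jη` with `M ≤ R₁M₁(a₁/ε₁)`.  Likewise the Sect. F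
conclusion is typed with its printed ceiling (p. 300 *«M = M′R₁M₁, M′ is an integer»*, p. 305 *«The condition M′ε₁ ≤ a₁
implies M′B₃ε₁ ≤ a₅, hence we have proved the regularity conditions (9), (10)»*, i.e. `M ≤ R₁M₁(a₁/ε₁)`), where the
tree's `B11.SectFPrinted` has `∃ RM`.  PROVED here: the exact forms imply the tree's forms (`thm1Printed_of_exact`,
`sectFPrinted_of_exact`), and the paper's architecture Thm 1 ⇐ Prop 7 ∧ Prop 8 ∧ Sect. F (pp. 281, 299, 304–305) in the
exact form (`thm1Exact_of_prop7_prop8_sectF`; same bookkeeping as the tree's `B11.thm1_of_prop7_prop8_sectF`, with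
a₁ := min{a′₁, a₁(F), a₅/(O(1)C₁B₃), a₀/B₃}).  Carriers, dictionary `VarProblemX.Laws` and the printed propositions are
the tree's (`…Balaban1983to89.B11`), used BY NAME; nothing is restated.  Unit `lit-balaban-r08` (skeleton rows r08.10,
r08.80, r08.92 of `HOME/lit-balaban-r08/SKELETON-r08.md`).
-/

namespace Literature.MathematicalPhysics.QuantumFieldTheory.Balaban1983to89.B11Thm1Exact

open B11

variable {I : Type}

/-- **Theorem 1** (p. 279 [PDF 3]) verbatim INCLUDING its last sentence: *«There exist positive constants a₀, a₁, B₃,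
B₄(β₀), M(ε₁), B₃a₁ ≤ a₀, such that for an arbitrary configuration V satisfying (7) with ε₁ ≤ a₁ there exists a minimal
orbit in the space 𝔘_k({Ω_j}, B₃ε₁) ∩ 𝔅_k(𝔅_k, V). (8) This orbit is a unique critical orbit in the space (6) if
B₃ε₁ ≤ ε₀ and ε₀ ≤ a₀. The minimal configurations U have the following regularity properties: for an arbitrary cube □
in the class described above, of a size 2ML^jη, M ≤ M(ε₁), there exists a gauge transformation u defined on a
neighborhood of □ and such that on □, U^{u^{-1}} = e^{iηA}, [(9), (10)]. The constants a₀, a₁, B₃, depend on d and L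
only, the constants B₄(β₀), M(ε₁) depend on the indicated parameters also. More exactly M(ε₁) = R₁M₁(a₁/ε₁).»*
`R₁M₁` = the fixed number R₁·M₁ of (1), p. 277; quantifier order as in `B11.Thm1Printed` (constants BEFORE the
instance `i`, V, ε₁, ε₀), with `M(ε₁) := R₁M₁(a₁/ε₁)`. [cite: Balaban1985Variational, Thm 1 p.279] -/
def Thm1PrintedExact (R₁M₁ : ℝ) (fam : I → VarProblem) : Prop :=
  ∃ a₀ a₁ B₃ B₄ : ℝ,
    0 < a₀ ∧ 0 < a₁ ∧ 0 < B₃ ∧ 0 < B₄ ∧ B₃ * a₁ ≤ a₀ ∧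
    ∀ i : I, ∀ ε₁ : ℝ, 0 < ε₁ → ε₁ ≤ a₁ → ∀ V : (fam i).Bdry, (fam i).Reg7 ε₁ V →
      (∃ U : (fam i).Cfg, (fam i).InU (B₃ * ε₁) U ∧ (fam i).InB V U ∧ (fam i).OnMinimalOrbit (B₃ * ε₁) V U) ∧
      (∀ ε₀ : ℝ, B₃ * ε₁ ≤ ε₀ → ε₀ ≤ a₀ →
        ∀ U, (fam i).OnMinimalOrbit (B₃ * ε₁) V U → (fam i).UniqueCriticalOrbit ε₀ V U) ∧
      (∀ U, (fam i).OnMinimalOrbit (B₃ * ε₁) V U →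
        ∀ c : (fam i).Cube, (fam i).sizeM c ≤ R₁M₁ * (a₁ / ε₁) → Regularity (fam i) B₃ B₄ ε₁ U c)

/-- The conclusion of **Sect. F** with its printed ceiling (p. 300 [PDF 24]: *«In both cases M ≥ R₁M₁ and we assume that
M is a multiple of R₁M₁, i.e. M = M′R₁M₁, M′ is an integer»*; p. 305 [PDF 29]: *«The condition M′ε₁ ≤ a₁ implies
M′B₃ε₁ ≤ a₅, hence we have proved the regularity conditions (9), (10), and the proof of Theorem 1 is completed.»*):
as the tree's `B11.SectFPrinted` but with the cube-size ceiling `R₁M₁(a₁/ε₁)` for the FIXED `R₁M₁` instead of an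
existential `RM`. [cite: Balaban1985Variational, Sect. F (169) pp.300–305] -/
def SectFPrintedExact (B₃ R₁M₁ : ℝ) (fam : I → VarProblemX) : Prop :=
  ∃ a₁ B₄ : ℝ, 0 < a₁ ∧ 0 < B₄ ∧
    ∀ i : I, ∀ ε₁ : ℝ, ∀ V : (fam i).Bdry, ∀ U : (fam i).Cfg, 0 < ε₁ → ε₁ ≤ a₁ → (fam i).Reg7 ε₁ V →
      (fam i).InU (B₃ * ε₁) U → (fam i).InB V U → (fam i).IsCritical V U →
        ∀ c : (fam i).Cube, (fam i).sizeM c ≤ R₁M₁ * (a₁ / ε₁) → Regularity (fam i).toVarProblem B₃ B₄ ε₁ U c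

/-- The exact form of Theorem 1 implies the tree's `B11.Thm1Printed` (take `Mfun := fun e => R₁M₁ (a₁/e)`, positive
for `R₁M₁ > 0`). [cite: Balaban1985Variational, Thm 1 p.279] -/
theorem thm1Printed_of_exact {R₁M₁ : ℝ} (hR : 0 < R₁M₁) (fam : I → VarProblem)
    (h : Thm1PrintedExact R₁M₁ fam) : Thm1Printed fam := by
  obtain ⟨a₀, a₁, B₃, B₄, ha₀, ha₁, hB₃, hB₄, hBa, H⟩ := h
  refine ⟨a₀, a₁, B₃, B₄, fun e => R₁M₁ * (a₁ / e), ha₀, ha₁, hB₃, hB₄, hBa, ?_, H⟩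
  intro e he
  positivity

/-- The exact Sect. F conclusion implies the tree's `B11.SectFPrinted` (`RM := R₁M₁`).
[cite: Balaban1985Variational, Sect. F (169) pp.300–305] -/
theorem sectFPrinted_of_exact {B₃ R₁M₁ : ℝ} (hR : 0 < R₁M₁) (fam : I → VarProblemX)
    (h : SectFPrintedExact B₃ R₁M₁ fam) : SectFPrinted B₃ fam := by
  obtain ⟨a₁, B₄, ha₁, hB₄, H⟩ := h
  exact ⟨a₁, B₄, R₁M₁, ha₁, hB₄, hR, H⟩

/-- **Theorem 1 (exact form) ⇐ Proposition 7 + Proposition 8 + Sect. F (exact form)** — the architecture of pp. 281,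
299, 304–305 (*«This will prove Theorem 1 with worse bounds. Next we will improve the bounds and we will complete the
proof of this theorem»*; *«Now we define a₁ as a largest constant such, that the restriction ε₁ ≤ a₁ implies all the
other restrictions we have imposed on ε₁»*), over the tree's carriers and dictionary `VarProblemX.Laws`, with the
printed ceiling `M(ε₁) = R₁M₁(a₁/ε₁)` carried through; a₁ := min{a′₁, a₁(F), a₅/(O(1)C₁B₃), a₀/B₃} (so that
`R₁M₁(a₁/ε₁) ≤ R₁M₁(a₁(F)/ε₁)`).  Same bookkeeping as `B11.thm1_of_prop7_prop8_sectF`.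
[cite: Balaban1985Variational, Thm 1 p.279 + Sect. F p.304–305] -/
theorem thm1Exact_of_prop7_prop8_sectF (fam : I → VarProblemX) (B₃ C₁ R₁M₁ : ℝ) (hB₃ : 0 < B₃) (hC₁ : 0 < C₁)
    (hR : 0 < R₁M₁) (laws : ∀ i, (fam i).Laws) (h7 : Prop7Printed B₃ C₁ fam) (h8 : Prop8Printed B₃ fam)
    (hF : SectFPrintedExact B₃ R₁M₁ fam) : Thm1PrintedExact R₁M₁ (fun i => (fam i).toVarProblem) := by
  obtain ⟨a₀, a₁', O₁, ha₀, ha₁', hO₁, H7⟩ := h7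
  obtain ⟨a₅, ha₅, H8⟩ := h8
  obtain ⟨aF, B₄, haF, hB₄, HF⟩ := hF
  have hK : 0 < O₁ * C₁ * B₃ := by positivity
  -- the final a₁ of p. 304
  set a₁ : ℝ := min (min a₁' aF) (min (a₅ / (O₁ * C₁ * B₃)) (a₀ / B₃)) with ha₁def
  have ha₁pos : 0 < a₁ := by
    simp only [ha₁def, lt_min_iff]
    exact ⟨⟨ha₁', haF⟩, div_pos ha₅ hK, div_pos ha₀ hB₃⟩
  have h1 : a₁ ≤ a₁' := le_trans (min_le_left _ _) (min_le_left _ _)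
  have h2 : a₁ ≤ aF := le_trans (min_le_left _ _) (min_le_right _ _)
  have h3 : a₁ ≤ a₅ / (O₁ * C₁ * B₃) := le_trans (min_le_right _ _) (min_le_left _ _)
  have h4 : a₁ ≤ a₀ / B₃ := le_trans (min_le_right _ _) (min_le_right _ _)
  refine ⟨a₀, a₁, B₃, B₄, ha₀, ha₁pos, hB₃, hB₄, ?_, ?_⟩
  · have := (le_div_iff₀ hB₃).1 h4
    linarith [mul_comm B₃ a₁]
  intro i ε₁ hε₁ hε₁a V hV
  obtain ⟨Lmono, Lmin, Lrestr, Luniq⟩ := laws i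
  -- existence (p. 304): Prop 7 gives a minimal orbit with ε₀ = O(1)C₁B₃ε₁, Prop 8 puts it into (8)
  have hex : ∃ U : (fam i).Cfg, (fam i).InU (B₃ * ε₁) U ∧ (fam i).InB V U ∧
      (fam i).OnMinimalOrbit (B₃ * ε₁) V U := by
    obtain ⟨U, hU⟩ := (H7 i a₀ ε₁ hε₁ V hV).2 (le_trans hε₁a h1)
    obtain ⟨hc, hIn, hB⟩ := Lmin _ V U hU
    have hε₀a₅ : O₁ * C₁ * B₃ * ε₁ ≤ a₅ := by
      have := (le_div_iff₀ hK).1 h3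
      nlinarith
    have h8U := H8 i (O₁ * C₁ * B₃ * ε₁) ε₁ hε₁ V U hV hIn hB hc hε₀a₅
    exact ⟨U, h8U, hB, Lrestr _ _ V U hU h8U⟩
  refine ⟨hex, ?_, ?_⟩
  · intro ε₀ hlo hhi U hU
    obtain ⟨hc, hIn, hB⟩ := Lmin _ V U hU
    have hIn0 : (fam i).InU ε₀ U := Lmono _ _ U hlo hIn
    have hAM := (H7 i ε₀ ε₁ hε₁ V hV).1 hhi hlo
    exact Luniq ε₀ V U hIn0 hB hc (fun U' h1' h2' h3' => hAM U' U h1' h2' h3' hIn0 hB hc)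
  · intro U hU c hc
    obtain ⟨hcrit, hIn, hB⟩ := Lmin _ V U hU
    have hcF : (fam i).sizeM c ≤ R₁M₁ * (aF / ε₁) := by
      refine le_trans hc ?_
      have : a₁ / ε₁ ≤ aF / ε₁ := div_le_div_of_nonneg_right h2 hε₁.le
      nlinarith
    exact HF i ε₁ V U hε₁ (le_trans hε₁a h2) hV hIn hB hcrit c hcF

end Literature.MathematicalPhysics.QuantumFieldTheory.Balaban1983to89.B11Thm1Exact
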